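import Mathlib
import Summits.ValiantsHypothesis.ValiantsHypothesis.Theorems.NewtonUnitEquationsDissociatedUniformTotalsLawCircleMultipliers
import HarnessLib

/-!
# Crux `NewtonUnitEquations.DissociatedUniform` (stmt-ValiantsHypothesis-5905): TOTALS `T ≤ 3q²` in the dominant regime for pairs with
# sharp-topped fibres and an ARBITRARILY RELABELLED strictly convex third polygon — the totals do not see the labelling of `c`

Memo `Cruxes/DissociatedUniform/NOTES-d1g3.md` §2 L5 (dominant regime: `T = q² + #bridges ≤ 2q²` in general position) / NOTES-t1g8 §2.
`…TotalsLawLargeThird` has `T ≤ V_P + 2q + 14q²` for arbitrary `a, b` and injective `c`; `…TotalsLawCoOrientedRigid` /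
`…TotalsLawCircleMultipliers` show that the POINTWISE count depends on the labelling of the third polygon (co-oriented `≤ 4q`,
contra-oriented circle `≤ 3q`, resonant star multiplier `≈ 0.6 q²`).  This file shows the TOTALS do not: for ANY pair `a, b` all of whose
fibres `x ↦ a x + b (r − x)` have sharp tops (e.g. two sampled circles with `A² ≠ B²`) and `c = c₀ ∘ σ` with `c₀` strictly convex ccw and
`σ` ANY permutation of the labels,

* **`sum_card_commonDir_le : Σ_s #{CommonDir_s} ≤ 3q²`** — each fibre edge `{x, x+1}` of `P_r` has ONE exposing direction (up to scale),
  at which `c` has at most two weak tops, and the blob index `z = s − r` is determined by the class: so the exposed-edge incidences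
  `(s, z, x)` number at most `2q²`, on top of the `q²` from the cone sweep count;
* **`totalVert_smul_le_three_mul_sq`**: `∃ μ₀, ∀ μ ≥ μ₀, T(a, b, μ•(c₀ ∘ σ)) ≤ 3q²`; for two sampled circles and a circle read through ANY
  unit multiplier **`totalVert_trigMul_smul_le`** (`T ≤ 3q²`, including the resonant multipliers where one class holds `≈ 0.6 q²`).
* APPENDIX (general position): `FibreEdgeGP` (a weight exposing a fibre edge has a unique top on `C` — no fibre edge parallel to an
  equally oriented edge of `C`; generic) ⇒ `sum_card_edgeHit_le_of_gp` (`≤ q²`), **`totalVert_smul_le_two_mul_sq_of_gp : T ≤ 2q²`** —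
  the memo's SHARP constant `2` ("`T = q² + #bridges`") on this stratum; `totalVert_trigMul_smul_le_of_gp` for circles.
Honest label: a totals law on a stratum in the dominant regime (constant `3` unconditionally, `2` in general position); `SmoothSharpTotalsLaw`,
`TotalsLawThree` remain OPEN; nothing here bears on VP ≠ VNP.
[folklore]
-/

set_option linter.dupNamespace false -- `ValiantsHypothesis.ValiantsHypothesis` (summit = problem) in every name

open scoped BigOperators

namespace Summit.ValiantsHypothesis.ValiantsHypothesis.Theorems.NewtonUnitEquationsDissociatedUniform

namespace TotalsLaw

open Matrix Real

section SharpFibreTotals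

variable {q : ℕ} [NeZero q]

/-- The fibre curve over `r`: `x ↦ a x + b (r − x)` (so that `bpt a b s z = fibreCurve a b (s − z)`). -/
def fibreCurve (a b : ZMod q → (Fin 2 → ℝ)) (r : ZMod q) : ZMod q → (Fin 2 → ℝ) := fun x => a x + b (r - x)

omit [NeZero q] in
/-- `bpt a b s z = fibreCurve a b (s − z)`. [folklore] -/
theorem bpt_eq_fibreCurve (a b : ZMod q → (Fin 2 → ℝ)) (s z : ZMod q) : bpt a b s z = fibreCurve a b (s - z) := rfl

omit [NeZero q] in
/-- Weak tops of a label-translated curve. [folklore] -/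
theorem wTop_shift_iff (P : ZMod q → (Fin 2 → ℝ)) (x : ZMod q) (θ : Fin 2 → ℝ) (w : ZMod q) :
    WTop (fun w' => P (x + w')) θ w ↔ WTop P θ (x + w) := by
  constructor
  · intro h y
    have := h (y - x)
    simpa using this
  · intro h w'
    exact h (x + w')

omit [NeZero q] in
/-- Sharp tops survive a label translation. [folklore] -/
theorem SharpTops.shift {P : ZMod q → (Fin 2 → ℝ)} (hP : SharpTops P) (x : ZMod q) : SharpTops fun w => P (x + w) := by
  intro θ hθ
  obtain ⟨h1, h2⟩ := hP θ hθ
  refine ⟨fun u v hu hv => ?_, fun u v w hu hv hw => ?_⟩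
  · rw [wTop_shift_iff] at hu hv
    rcases h1 _ _ hu hv with e | e | e
    · left; exact add_left_cancel e
    · right; left; exact add_left_cancel (by rw [e]; ring)
    · right; right; exact add_left_cancel (by rw [e]; ring)
  · rw [wTop_shift_iff] at hu hv hw
    rcases h2 _ _ _ hu hv hw with e | e | e
    · left; exact add_left_cancel e
    · right; left; exact add_left_cancel e
    · right; right; exact add_left_cancel e

/-- The edge `{x, x+1}` of a sharp-topped curve (`P (x+1) ≠ P x`) is exposed inside the cones of at most TWO vertices of a curve `c` with
at most two weak tops per weight (all exposing weights are one direction). [folklore] -/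
theorem card_wTop_exposing_edge_le_two {c : ZMod q → (Fin 2 → ℝ)}
    (hc : ∀ θ : Fin 2 → ℝ, θ ≠ 0 → ∀ x y w : ZMod q, WTop c θ x → WTop c θ y → WTop c θ w → x = y ∨ y = w ∨ x = w)
    {P : ZMod q → (Fin 2 → ℝ)} (hP : SharpTops P) (hq : 3 ≤ q) (x : ZMod q) (hx : P (x + 1) ≠ P x) [DecidablePred fun z : ZMod q =>
      ∃ θ : Fin 2 → ℝ, θ ≠ 0 ∧ WTop c θ z ∧ WTop P θ x ∧ WTop P θ (x + 1)] :
    (Finset.univ.filter fun z : ZMod q => ∃ θ : Fin 2 → ℝ, θ ≠ 0 ∧ WTop c θ z ∧ WTop P θ x ∧ WTop P θ (x + 1)).card ≤ 2 := by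
  classical
  have h := card_wTop_exposing_le_two' hc (hP.shift x) hq (by simpa using hx)
  refine le_trans (le_of_eq (congrArg Finset.card (Finset.filter_congr fun z _ => ?_))) h
  simp only [wTop_shift_iff, add_zero]

open scoped Classical in
/-- **The exposed-edge incidences `(s, z, x)` number at most `2q²`** (pairs with sharp-topped fibres whose consecutive fibre points are
distinct; `c` with at most two weak tops per weight). [folklore] -/
theorem sum_card_edgeHit_le (a b c : ZMod q → (Fin 2 → ℝ)) (hq : 3 ≤ q)
    (hc : ∀ θ : Fin 2 → ℝ, θ ≠ 0 → ∀ x y w : ZMod q, WTop c θ x → WTop c θ y → WTop c θ w → x = y ∨ y = w ∨ x = w)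
    (hP : ∀ r, SharpTops (fibreCurve a b r)) (hinj : ∀ r x, fibreCurve a b r (x + 1) ≠ fibreCurve a b r x) :
    ∑ s : ZMod q, (Finset.univ.filter fun zx : ZMod q × ZMod q => EdgeHit a b c s zx.1 zx.2).card ≤ 2 * q ^ 2 := by
  -- the incidence predicate indexed by (class, fibre, letter)
  set Q : ZMod q → ZMod q × ZMod q → Prop := fun s rx => ∃ θ : Fin 2 → ℝ, θ ≠ 0 ∧ WTop c θ (s - rx.1) ∧
    WTop (fibreCurve a b rx.1) θ rx.2 ∧ WTop (fibreCurve a b rx.1) θ (rx.2 + 1) with hQ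
  -- re-index the blob by the fibre: `z = s − r`
  have hre : ∀ s : ZMod q, (Finset.univ.filter fun zx : ZMod q × ZMod q => EdgeHit a b c s zx.1 zx.2).card =
      (Finset.univ.filter fun rx : ZMod q × ZMod q => Q s rx).card := by
    intro s
    refine Finset.card_equiv ((Equiv.subLeft s).prodCongr (Equiv.refl _)) fun zx => ?_
    simp only [Finset.mem_filter, Finset.mem_univ, true_and, Equiv.prodCongr_apply, Equiv.coe_refl, Prod.map_fst, Prod.map_snd,
      Equiv.subLeft_apply, id_eq, EdgeHit, bpt_eq_fibreCurve, sub_sub_cancel, hQ]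
  simp_rw [hre]
  -- Fubini
  have hfub : ∑ s : ZMod q, (Finset.univ.filter fun rx : ZMod q × ZMod q => Q s rx).card =
      ∑ rx : ZMod q × ZMod q, (Finset.univ.filter fun s : ZMod q => Q s rx).card := by
    simp only [Finset.card_filter]
    rw [Finset.sum_comm]
  rw [hfub]
  -- each fibre edge is exposed in at most two cones
  have hper : ∀ rx : ZMod q × ZMod q, (Finset.univ.filter fun s : ZMod q => Q s rx).card ≤ 2 := by
    intro rx
    have h2 := card_wTop_exposing_edge_le_two hc (hP rx.1) hq rx.2 (hinj rx.1 rx.2)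
    refine le_trans (le_of_eq ?_) h2
    refine Finset.card_equiv (Equiv.subRight rx.1) fun s => ?_
    simp only [Finset.mem_filter, Finset.mem_univ, true_and, Equiv.subRight_apply, hQ]
  calc ∑ rx : ZMod q × ZMod q, (Finset.univ.filter fun s : ZMod q => Q s rx).card ≤ ∑ _rx : ZMod q × ZMod q, 2 :=
        Finset.sum_le_sum fun rx _ => hper rx
    _ = 2 * q ^ 2 := by rw [Finset.sum_const, Finset.card_univ, Fintype.card_prod, ZMod.card, smul_eq_mul]; ring

open scoped Classical in
/-- **`Σ_s #{CommonDir_s} ≤ 3q²`** for a pair with sharp-topped fibres (consecutive fibre points distinct) and a relabelled strictly convex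
ccw third polygon `c₀ ∘ σ` (`q ≥ 3`). [folklore] -/
theorem sum_card_commonDir_le (a b : ZMod q → (Fin 2 → ℝ)) {c₀ : ZMod q → (Fin 2 → ℝ)} (hc₀ : StrictlyConvexCcw c₀) (hq : 3 ≤ q)
    (σ : ZMod q ≃ ZMod q) (hP : ∀ r, SharpTops (fibreCurve a b r)) (hinj : ∀ r x, fibreCurve a b r (x + 1) ≠ fibreCurve a b r x) :
    ∑ s : ZMod q, (Finset.univ.filter fun zx : ZMod q × ZMod q => CommonDir a b (c₀ ∘ σ) s zx.1 zx.2).card ≤ 3 * q ^ 2 := by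
  have hc3 : ∀ θ : Fin 2 → ℝ, θ ≠ 0 → ∀ x y w : ZMod q,
      WTop (c₀ ∘ σ) θ x → WTop (c₀ ∘ σ) θ y → WTop (c₀ ∘ σ) θ w → x = y ∨ y = w ∨ x = w := by
    intro θ hθ x y w hx hy hw
    rw [wTop_comp_equiv] at hx hy hw
    rcases (sharpTops_of_strictlyConvexCcw hc₀ hq θ hθ).2 _ _ _ hx hy hw with e | e | e
    · left; exact σ.injective e
    · right; left; exact σ.injective e
    · right; right; exact σ.injective e
  have hP' : ∀ s z, SharpTops (bpt a b s z) := fun s z => by rw [bpt_eq_fibreCurve]; exact hP (s - z)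
  calc ∑ s : ZMod q, (Finset.univ.filter fun zx : ZMod q × ZMod q => CommonDir a b (c₀ ∘ σ) s zx.1 zx.2).card
      ≤ ∑ s : ZMod q, (q + (Finset.univ.filter fun zx : ZMod q × ZMod q => EdgeHit a b (c₀ ∘ σ) s zx.1 zx.2).card) :=
        Finset.sum_le_sum fun s _ => card_commonDir_le_add_comp a b hc₀ hq σ s (hP' s)
    _ = q ^ 2 + ∑ s : ZMod q, (Finset.univ.filter fun zx : ZMod q × ZMod q => EdgeHit a b (c₀ ∘ σ) s zx.1 zx.2).card := by
        rw [Finset.sum_add_distrib, Finset.sum_const, Finset.card_univ, ZMod.card, smul_eq_mul]; ring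
    _ ≤ q ^ 2 + 2 * q ^ 2 := Nat.add_le_add_left (sum_card_edgeHit_le a b (c₀ ∘ σ) hq hc3 hP hinj) _
    _ = 3 * q ^ 2 := by ring

/-- **TOTALS `T ≤ 3q²` in the dominant regime** for a pair with sharp-topped fibres (consecutive fibre points distinct) and an arbitrarily
relabelled strictly convex third polygon. [folklore] -/
theorem totalVert_smul_le_three_mul_sq (a b : ZMod q → (Fin 2 → ℝ)) {c₀ : ZMod q → (Fin 2 → ℝ)} (hc₀ : StrictlyConvexCcw c₀)
    (hq : 3 ≤ q) (σ : ZMod q ≃ ZMod q) (hP : ∀ r, SharpTops (fibreCurve a b r))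
    (hinj : ∀ r x, fibreCurve a b r (x + 1) ≠ fibreCurve a b r x) :
    ∃ μ₀ : ℝ, ∀ μ : ℝ, μ₀ ≤ μ → totalVert a b (μ • (c₀ ∘ σ)) ≤ 3 * q ^ 2 := by
  classical
  choose f hf using fun s => classVert_smul_le_card_commonDir a b (c₀ ∘ σ) s
  refine ⟨Finset.univ.sup' Finset.univ_nonempty f, fun μ hμ => ?_⟩
  unfold totalVert
  calc ∑ s, classVert a b (μ • (c₀ ∘ σ)) s
      ≤ ∑ s : ZMod q, (Finset.univ.filter fun zx : ZMod q × ZMod q => CommonDir a b (c₀ ∘ σ) s zx.1 zx.2).card :=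
        Finset.sum_le_sum fun s _ => hf s μ ((Finset.le_sup' f (Finset.mem_univ s)).trans hμ)
    _ ≤ 3 * q ^ 2 := sum_card_commonDir_le a b hc₀ hq σ hP hinj

/-- **Three sampled circles, the third read through ANY unit multiplier: `T ≤ 3q²`** in the dominant regime (`A² ≠ B²`, `A₃ ≠ 0`, `q ≥ 3`) —
including the resonant multipliers `2m + 1 ≡ 0` for which ONE class holds `≈ 0.6 q²` vertices (census `exp/star_circle.py`). [folklore] -/
theorem totalVert_trigMul_smul_le (hq : 3 ≤ q) (m : (ZMod q)ˣ) (c₁ c₂ c₃ : Fin 2 → ℝ) {A B A₃ : ℝ} (hAB : A ^ 2 ≠ B ^ 2)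
    (hA₃ : A₃ ≠ 0) (φ ψ φ₃ : ℝ) :
    ∃ μ₀ : ℝ, ∀ μ : ℝ, μ₀ ≤ μ → totalVert (trigCurve c₁ A φ) (trigCurve c₂ B ψ) (μ • trigMul c₃ A₃ φ₃ m) ≤ 3 * q ^ 2 := by
  have hc₀ : StrictlyConvexCcw (trigCurve (q := q) c₃ A₃ φ₃) := strictlyConvexCcw_trigCurve hq c₃ hA₃ φ₃
  -- WLOG `B² < A²` (swap the circles otherwise): sharp-topped, strictly convex fibres
  have key : ∀ (c₁ c₂ : Fin 2 → ℝ) (A B φ ψ : ℝ), B ^ 2 < A ^ 2 →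
      ∃ μ₀ : ℝ, ∀ μ : ℝ, μ₀ ≤ μ → totalVert (trigCurve c₁ A φ) (trigCurve c₂ B ψ) (μ • trigMul c₃ A₃ φ₃ m) ≤ 3 * q ^ 2 := by
    intro c₁ c₂ A B φ ψ hlt
    have hconv : ∀ r, StrictlyConvexCcw (fibreCurve (trigCurve (q := q) c₁ A φ) (trigCurve c₂ B ψ) r) := fun r => by
      have := strictlyConvexCcw_bpt_trigCurve hq c₁ c₂ hlt φ ψ r 0
      rwa [bpt_eq_fibreCurve, sub_zero] at this
    have hP : ∀ r, SharpTops (fibreCurve (trigCurve (q := q) c₁ A φ) (trigCurve c₂ B ψ) r) :=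
      fun r => sharpTops_of_strictlyConvexCcw (hconv r) hq
    have hinj : ∀ r x, fibreCurve (trigCurve (q := q) c₁ A φ) (trigCurve c₂ B ψ) r (x + 1) ≠
        fibreCurve (trigCurve c₁ A φ) (trigCurve c₂ B ψ) r x := fun r x => (hconv r).succ_ne hq x
    have h := totalVert_smul_le_three_mul_sq (trigCurve c₁ A φ) (trigCurve c₂ B ψ) hc₀ hq (m.mulLeft : ZMod q ≃ ZMod q) hP hinj
    rwa [← trigMul_eq_comp] at h
  rcases lt_or_gt_of_ne hAB with hlt | hgt
  · obtain ⟨μ₀, h⟩ := key c₂ c₁ B A ψ φ hlt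
    refine ⟨μ₀, fun μ hμ => ?_⟩
    rw [totalVert_swap]
    exact h μ hμ
  · exact key c₁ c₂ A B φ ψ hgt

/-! ### Appendix: general position — the SHARP constant `2` -/

/-- GENERAL POSITION of the pair fibres against the third polygon: a weight exposing an EDGE of a fibre has a UNIQUE weak top on `C`
(no fibre edge is parallel to and oriented like an edge of `C`; generic in the phases). -/
def FibreEdgeGP (a b c : ZMod q → (Fin 2 → ℝ)) : Prop :=
  ∀ (r x : ZMod q) (θ : Fin 2 → ℝ), θ ≠ 0 → WTop (fibreCurve a b r) θ x → WTop (fibreCurve a b r) θ (x + 1) →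
    ∀ z z' : ZMod q, WTop c θ z → WTop c θ z' → z = z'

open scoped Classical in
/-- Under general position each fibre edge is exposed inside exactly ONE cone: the incidences number at most `q²`. [folklore] -/
theorem sum_card_edgeHit_le_of_gp (a b c : ZMod q → (Fin 2 → ℝ)) (hq : 3 ≤ q) (hgp : FibreEdgeGP a b c)
    (hP : ∀ r, SharpTops (fibreCurve a b r)) (hinj : ∀ r x, fibreCurve a b r (x + 1) ≠ fibreCurve a b r x) :
    ∑ s : ZMod q, (Finset.univ.filter fun zx : ZMod q × ZMod q => EdgeHit a b c s zx.1 zx.2).card ≤ q ^ 2 := by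
  set Q : ZMod q → ZMod q × ZMod q → Prop := fun s rx => ∃ θ : Fin 2 → ℝ, θ ≠ 0 ∧ WTop c θ (s - rx.1) ∧
    WTop (fibreCurve a b rx.1) θ rx.2 ∧ WTop (fibreCurve a b rx.1) θ (rx.2 + 1) with hQ
  have hre : ∀ s : ZMod q, (Finset.univ.filter fun zx : ZMod q × ZMod q => EdgeHit a b c s zx.1 zx.2).card =
      (Finset.univ.filter fun rx : ZMod q × ZMod q => Q s rx).card := by
    intro s
    refine Finset.card_equiv ((Equiv.subLeft s).prodCongr (Equiv.refl _)) fun zx => ?_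
    simp only [Finset.mem_filter, Finset.mem_univ, true_and, Equiv.prodCongr_apply, Equiv.coe_refl, Prod.map_fst, Prod.map_snd,
      Equiv.subLeft_apply, id_eq, EdgeHit, bpt_eq_fibreCurve, sub_sub_cancel, hQ]
  simp_rw [hre]
  have hfub : ∑ s : ZMod q, (Finset.univ.filter fun rx : ZMod q × ZMod q => Q s rx).card =
      ∑ rx : ZMod q × ZMod q, (Finset.univ.filter fun s : ZMod q => Q s rx).card := by
    simp only [Finset.card_filter]
    rw [Finset.sum_comm]
  rw [hfub]
  -- each fibre edge is exposed in at most ONE cone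
  have hper : ∀ rx : ZMod q × ZMod q, (Finset.univ.filter fun s : ZMod q => Q s rx).card ≤ 1 := by
    intro rx
    refine Finset.card_le_one.2 fun s hs s' hs' => ?_
    simp only [Finset.mem_filter, Finset.mem_univ, true_and, hQ] at hs hs'
    obtain ⟨θ, hθ, hz, h0, h1⟩ := hs
    obtain ⟨θ', hθ', hz', h0', h1'⟩ := hs'
    -- both weights expose the same edge: they are positive multiples
    obtain ⟨t, ht, rfl⟩ := exposing_unique ((hP rx.1).shift rx.2) hq (by simpa using hinj rx.1 rx.2) hθ hθ'
      (by simpa [wTop_shift_iff] using h0) (by simpa [wTop_shift_iff] using h1)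
      (by simpa [wTop_shift_iff] using h0') (by simpa [wTop_shift_iff] using h1')
    rw [wTop_smul_iff c ht] at hz'
    have := hgp rx.1 rx.2 θ hθ h0 h1 (s - rx.1) (s' - rx.1) hz hz'
    exact sub_left_injective this
  calc ∑ rx : ZMod q × ZMod q, (Finset.univ.filter fun s : ZMod q => Q s rx).card ≤ ∑ _rx : ZMod q × ZMod q, 1 :=
        Finset.sum_le_sum fun rx _ => hper rx
    _ = q ^ 2 := by rw [Finset.sum_const, Finset.card_univ, Fintype.card_prod, ZMod.card, smul_eq_mul]; ring

open scoped Classical in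
/-- **`Σ_s #{CommonDir_s} ≤ 2q²` under general position** (sharp-topped fibres, relabelled strictly convex ccw `c₀ ∘ σ`, `q ≥ 3`). [folklore] -/
theorem sum_card_commonDir_le_of_gp (a b : ZMod q → (Fin 2 → ℝ)) {c₀ : ZMod q → (Fin 2 → ℝ)} (hc₀ : StrictlyConvexCcw c₀) (hq : 3 ≤ q)
    (σ : ZMod q ≃ ZMod q) (hgp : FibreEdgeGP a b (c₀ ∘ σ)) (hP : ∀ r, SharpTops (fibreCurve a b r))
    (hinj : ∀ r x, fibreCurve a b r (x + 1) ≠ fibreCurve a b r x) :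
    ∑ s : ZMod q, (Finset.univ.filter fun zx : ZMod q × ZMod q => CommonDir a b (c₀ ∘ σ) s zx.1 zx.2).card ≤ 2 * q ^ 2 := by
  have hP' : ∀ s z, SharpTops (bpt a b s z) := fun s z => by rw [bpt_eq_fibreCurve]; exact hP (s - z)
  calc ∑ s : ZMod q, (Finset.univ.filter fun zx : ZMod q × ZMod q => CommonDir a b (c₀ ∘ σ) s zx.1 zx.2).card
      ≤ ∑ s : ZMod q, (q + (Finset.univ.filter fun zx : ZMod q × ZMod q => EdgeHit a b (c₀ ∘ σ) s zx.1 zx.2).card) :=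
        Finset.sum_le_sum fun s _ => card_commonDir_le_add_comp a b hc₀ hq σ s (hP' s)
    _ = q ^ 2 + ∑ s : ZMod q, (Finset.univ.filter fun zx : ZMod q × ZMod q => EdgeHit a b (c₀ ∘ σ) s zx.1 zx.2).card := by
        rw [Finset.sum_add_distrib, Finset.sum_const, Finset.card_univ, ZMod.card, smul_eq_mul]; ring
    _ ≤ q ^ 2 + q ^ 2 := Nat.add_le_add_left (sum_card_edgeHit_le_of_gp a b (c₀ ∘ σ) hq hgp hP hinj) _
    _ = 2 * q ^ 2 := by ring

/-- **THE SHARP DOMINANT-REGIME TOTALS LAW on the sharp-fibre stratum**: under general position, `T(a, b, μ•(c₀ ∘ σ)) ≤ 2q²` for `μ ≥ μ₀`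
(memo NOTES-d1g3 §2 L5: "`T = q² + #bridges ≤ 2q²`", the constant `2` of `SharpTotalsLawThree`). [folklore] -/
theorem totalVert_smul_le_two_mul_sq_of_gp (a b : ZMod q → (Fin 2 → ℝ)) {c₀ : ZMod q → (Fin 2 → ℝ)} (hc₀ : StrictlyConvexCcw c₀)
    (hq : 3 ≤ q) (σ : ZMod q ≃ ZMod q) (hgp : FibreEdgeGP a b (c₀ ∘ σ)) (hP : ∀ r, SharpTops (fibreCurve a b r))
    (hinj : ∀ r x, fibreCurve a b r (x + 1) ≠ fibreCurve a b r x) :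
    ∃ μ₀ : ℝ, ∀ μ : ℝ, μ₀ ≤ μ → totalVert a b (μ • (c₀ ∘ σ)) ≤ 2 * q ^ 2 := by
  classical
  choose f hf using fun s => classVert_smul_le_card_commonDir a b (c₀ ∘ σ) s
  refine ⟨Finset.univ.sup' Finset.univ_nonempty f, fun μ hμ => ?_⟩
  unfold totalVert
  calc ∑ s, classVert a b (μ • (c₀ ∘ σ)) s
      ≤ ∑ s : ZMod q, (Finset.univ.filter fun zx : ZMod q × ZMod q => CommonDir a b (c₀ ∘ σ) s zx.1 zx.2).card :=
        Finset.sum_le_sum fun s _ => hf s μ ((Finset.le_sup' f (Finset.mem_univ s)).trans hμ)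
    _ ≤ 2 * q ^ 2 := sum_card_commonDir_le_of_gp a b hc₀ hq σ hgp hP hinj

/-- **Two sampled circles and any relabelled sampled circle in general position: `T ≤ 2q²`** (dominant regime; `A² ≠ B²`, `A₃ ≠ 0`,
`q ≥ 3`). [folklore] -/
theorem totalVert_trigMul_smul_le_of_gp (hq : 3 ≤ q) (m : (ZMod q)ˣ) (c₁ c₂ c₃ : Fin 2 → ℝ) {A B A₃ : ℝ} (hAB : B ^ 2 < A ^ 2)
    (hA₃ : A₃ ≠ 0) (φ ψ φ₃ : ℝ) (hgp : FibreEdgeGP (trigCurve c₁ A φ) (trigCurve c₂ B ψ) (trigMul c₃ A₃ φ₃ m)) :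
    ∃ μ₀ : ℝ, ∀ μ : ℝ, μ₀ ≤ μ → totalVert (trigCurve c₁ A φ) (trigCurve c₂ B ψ) (μ • trigMul c₃ A₃ φ₃ m) ≤ 2 * q ^ 2 := by
  have hc₀ : StrictlyConvexCcw (trigCurve (q := q) c₃ A₃ φ₃) := strictlyConvexCcw_trigCurve hq c₃ hA₃ φ₃
  have hconv : ∀ r, StrictlyConvexCcw (fibreCurve (trigCurve (q := q) c₁ A φ) (trigCurve c₂ B ψ) r) := fun r => by
    have := strictlyConvexCcw_bpt_trigCurve hq c₁ c₂ hAB φ ψ r 0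
    rwa [bpt_eq_fibreCurve, sub_zero] at this
  have hP : ∀ r, SharpTops (fibreCurve (trigCurve (q := q) c₁ A φ) (trigCurve c₂ B ψ) r) :=
    fun r => sharpTops_of_strictlyConvexCcw (hconv r) hq
  have hinj : ∀ r x, fibreCurve (trigCurve (q := q) c₁ A φ) (trigCurve c₂ B ψ) r (x + 1) ≠
      fibreCurve (trigCurve c₁ A φ) (trigCurve c₂ B ψ) r x := fun r x => (hconv r).succ_ne hq x
  rw [trigMul_eq_comp] at hgp ⊢
  exact totalVert_smul_le_two_mul_sq_of_gp (trigCurve c₁ A φ) (trigCurve c₂ B ψ) hc₀ hq (m.mulLeft : ZMod q ≃ ZMod q) hgp hP hinj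


end SharpFibreTotals

end TotalsLaw

end Summit.ValiantsHypothesis.ValiantsHypothesis.Theorems.NewtonUnitEquationsDissociatedUniform
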